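import Summits.HodgeConjecture.CorCM.IrreducibleOddWeightsProductSpanBlocksMinimal
import Summits.HodgeConjecture.CorCM.IrreducibleOddWeightsProductSpanMinimalIndex
import HarnessLib

/-!
# Minimal block-non-additive sets of blocks have at most `[Gal(L/ℚ) : A] + 1` blocks; under an ABELIAN Galois closure
# the first exceptional mixed class across blocks lives on TWO blocks `X_c^{(π₁)} × X_{c'}^{(π₂)}`

COR-CM (cell `pub-hodgecm2`, binder seat `b16` gen 61, count-neutral claim BLOCKS ARE MEMBERS, file H6 — abstract
`G`-slots, CM fields and their realisations; theorems only, no definition, no named fact, no `sorry`).  NEW as stated,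
hence under `Summits/`.  HONEST FRAMING: unconditional structure theorems on Hodge classes of products of CM abelian
varieties; `HC_CM` is neither used nor asserted.

File H4 (`IrreducibleOddWeightsProductSpanMinimalIndex`) bounded minimal non-additive families of MEMBERS by the index
form `[G : A] + 1`; files H1–H3 made blocks into members.  Here the two are combined: a partition `κ : I ↠ C` into blocks
`X_c = ∏_{κ i = c} A_i` (nothing assumed inside a block), `T` block additive =
`rank(Σ|_{κ ∈ T}) + |T| = Σ_{c ∈ T} rank(Σ|_c) + 1` (`Hg(∏_{c ∈ T} X_c) = ∏_{c ∈ T} Hg(X_c)`).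

* §1 (abstract) **`IrrOdd.card_le_index_succ_fiber_of_minimal`** — `A ≤ G` of finite index acting through pairwise
  commuting permutations: a minimal block-non-additive set of blocks `C₀` has `|C₀| ≤ [G : A] + 1`;
  `IrrOdd.card_le_two_fiber_of_minimal_of_smul_comm` (commuting actions: TWO blocks).
* §2 (CM fields, `K_i ↪ L` Galois) **`card_le_index_succ_fiber_of_minimal`** (`A ≤ Gal(L/ℚ)` with pairwise commuting
  elements), **`card_le_two_fiber_of_minimal_of_comm`** (`Gal(L/ℚ)` abelian).
* §3 (realisations) **`exists_card_le_index_succ_not_hodgeClassesProductSpan_fiber`** — if `Hg(∏_i A_i) ⊊ ∏_c Hg(X_c)`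
  the first exceptional mixed class across blocks involves at most `[Gal(L/ℚ) : A] + 1` blocks;
  **`exists_pair_not_hodgeClassesProductSpan_fiber_of_comm`** — `Gal(L/ℚ)` ABELIAN: it lives on TWO blocks: some
  `(∏_j A_{π₁ j}) × (∏_j A_{π₂ j})` with `π₁` inside one block and `π₂` inside ONE other block carries a rational Hodge
  class which is not a `ℂ`-combination of exterior products (whatever happens inside the blocks).

## References

* [MoonenZarhin1999LowDim] B. Moonen, Yu. Zarhin, *Hodge classes on abelian varieties of low dimension*, Math. Ann.
  315 (1999), §3 (3.1), Remark (3.9).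
* [Serre1977] J.-P. Serre, *Linear Representations of Finite Groups*, GTM 42 (1977), §3.1 Thm. 9 and Cor.
* [Mai1989] L. Mai, *Lower bounds for the ranks of CM types*, J. Number Theory 32 (1989), §2 Prop. 1 (proof).
* [Gordon1999HodgeAVSurvey] B. B. Gordon, *A survey of the Hodge conjecture for abelian varieties*, §3 Theorem (Imai,
  Murty) with proof; 7.5–7.7.
* [Shimura1998] G. Shimura, *Abelian Varieties with Complex Multiplication and Modular Functions* (1998), §8.1.
-/

set_option autoImplicit false

noncomputable section

open scoped BigOperators

open CategoryTheory CategoryTheory.Limits NumberField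

namespace Summit.HodgeConjecture.CorCM

namespace IrrOdd

open Literature.NumberTheory.ComplexMultiplication

universe w u v

variable {G : Type w} [Group G] {I : Type u} {E : I → Type v} [∀ i, MulAction G (E i)] [Fintype I]
  [∀ i, Fintype (E i)] [∀ i, Nonempty (E i)] {C : Type*} [Fintype C] [DecidableEq C]

/-! ### §1 Abstract slots -/

omit [Fintype C] in
/-- **MINIMAL BLOCK-NON-ADDITIVE SETS OF BLOCKS HAVE AT MOST `[G : A] + 1` BLOCKS** (`A ≤ G` of finite index acting on
every slot through pairwise commuting permutations; `Φ_i` CM types for `ρ`, `κ : I ↠ C`, nothing assumed inside a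
block): if `C₀` is not block additive while every non-empty proper set of blocks of `C₀` is, then `|C₀| ≤ [G : A] + 1`
(H4's member statement for the regrouped family). [cite: Serre1977, §3.1 Cor. to Thm. 9] [cite: Mai1989, §2 Prop. 1 (proof)]
[cite: MoonenZarhin1999LowDim, §3 (3.1)] -/
theorem card_le_index_succ_fiber_of_minimal {ρ : G} {Φ : ∀ i, Set (E i)} (h : ∀ i, IsCMTypeWith ρ (Φ i))
    (κ : I → C) (hκ : Function.Surjective κ) (A : Subgroup G) [A.FiniteIndex]
    (hA : ∀ a ∈ A, ∀ b ∈ A, ∀ (i : I) (s : E i), a • b • s = b • a • s) (C₀ : Finset C)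
    (hnot : typeRank G (sigmaType fun i : {i // κ i ∈ C₀} => Φ i.1) + C₀.card ≠
      (∑ c ∈ C₀, typeRank G (sigmaType fun i : {i // κ i = c} => Φ i.1)) + 1)
    (hmin : ∀ T : Finset C, T ⊂ C₀ → T.Nonempty →
      typeRank G (sigmaType fun i : {i // κ i ∈ T} => Φ i.1) + T.card =
        (∑ c ∈ T, typeRank G (sigmaType fun i : {i // κ i = c} => Φ i.1)) + 1) :
    C₀.card ≤ A.index + 1 := by
  haveI : ∀ c : C, Nonempty (Σ i : {i // κ i = c}, E i.1) := fun c => by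
    obtain ⟨i, hi⟩ := hκ c
    exact ⟨⟨⟨i, hi⟩, Classical.arbitrary (E i)⟩⟩
  by_cases hC₀ : C₀.Nonempty
  · have hA' : ∀ a ∈ A, ∀ b ∈ A, ∀ (c : C) (x : Σ i : {i // κ i = c}, E i.1), a • b • x = b • a • x := by
      intro a ha b hb c x
      obtain ⟨⟨i, hi⟩, s⟩ := x
      change (⟨⟨i, hi⟩, a • b • s⟩ : Σ i : {i // κ i = c}, E i.1) = ⟨⟨i, hi⟩, b • a • s⟩
      rw [hA a ha b hb i s]
    refine card_le_index_succ_of_minimal_nonadditive (G := G) (E := fun c : C => Σ i : {i // κ i = c}, E i.1)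
      (fun c => sigmaType fun i : {i // κ i = c} => Φ i.1) A hA' C₀
      (fun H => hnot ((typeRank_fiber_add_card_eq_iff_finrank_eq h κ hκ C₀ hC₀).2 H)) fun T hT => ?_
    by_cases hTne : T.Nonempty
    · exact (typeRank_fiber_add_card_eq_iff_finrank_eq h κ hκ T hTne).1 (hmin T hT hTne)
    · rw [Finset.not_nonempty_iff_eq_empty.1 hTne]
      exact finrank_antiSpan_sigmaType_coe_empty_fiber_eq_sum (G := G) Φ κ
  · rw [Finset.not_nonempty_iff_eq_empty.1 hC₀, Finset.card_empty]
    exact Nat.zero_le _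

omit [Fintype C] in
/-- **Commuting permutations: minimal block interactions involve TWO blocks.** [cite: Serre1977, §3.1 Thm. 9]
[cite: MoonenZarhin1999LowDim, §3 (3.1) and Remark (3.9)] -/
theorem card_le_two_fiber_of_minimal_of_smul_comm {ρ : G} {Φ : ∀ i, Set (E i)} (h : ∀ i, IsCMTypeWith ρ (Φ i))
    (κ : I → C) (hκ : Function.Surjective κ) (hG : ∀ (a b : G) (i : I) (s : E i), a • b • s = b • a • s)
    (C₀ : Finset C)
    (hnot : typeRank G (sigmaType fun i : {i // κ i ∈ C₀} => Φ i.1) + C₀.card ≠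
      (∑ c ∈ C₀, typeRank G (sigmaType fun i : {i // κ i = c} => Φ i.1)) + 1)
    (hmin : ∀ T : Finset C, T ⊂ C₀ → T.Nonempty →
      typeRank G (sigmaType fun i : {i // κ i ∈ T} => Φ i.1) + T.card =
        (∑ c ∈ T, typeRank G (sigmaType fun i : {i // κ i = c} => Φ i.1)) + 1) :
    C₀.card ≤ 2 := by
  have key := card_le_index_succ_fiber_of_minimal h κ hκ (⊤ : Subgroup G) (fun a _ b _ i s => hG a b i s) C₀ hnot hmin
  rwa [Subgroup.index_top] at key

end IrrOdd

/-! ### §2 CM fields -/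

open Literature.NumberTheory.ComplexMultiplication
open Literature.AlgebraicGeometry.Motives (AbelianVariety CMType)
open Literature.AlgebraicGeometry.Motives.AbelianVariety
open Literature.AlgebraicGeometry.HodgeTheory
open Literature.AlgebraicGeometry.ComplexMultiplication (IsCMTypeRealisation)
open Literature.AlgebraicGeometry.Pohlmann1968

variable {I : Type} [Fintype I] {K : I → Type} [∀ i, Field (K i)] [∀ i, NumberField (K i)] [∀ i, IsCMField (K i)]
  {C : Type} [Fintype C] [DecidableEq C] {L : Type} [Field L] [NumberField L] [Normal ℚ L]

omit [Fintype C] in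
/-- **MINIMAL BLOCK-NON-ADDITIVE SETS OF BLOCKS HAVE AT MOST `[Gal(L/ℚ) : A] + 1` BLOCKS.**  CM fields `K_i ↪ L` (`L`
Galois over `ℚ`), `A ≤ Gal(L/ℚ)` with pairwise commuting elements, ARBITRARY CM types, a partition `κ : I ↠ C`: if
`Hg(∏_{c ∈ C₀} X_c) ⊊ ∏_{c ∈ C₀} Hg(X_c)` while every non-empty proper set of blocks of `C₀` is block additive, then
`|C₀| ≤ [Gal(L/ℚ) : A] + 1`. [cite: Serre1977, §3.1 Cor. to Thm. 9] [cite: MoonenZarhin1999LowDim, §3 (3.1)] [cite: Shimura1998, §8.1] -/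
theorem card_le_index_succ_fiber_of_minimal (ι : L →+* ℂ) (e : ∀ i, K i →+* L) (Φ : ∀ i, CMType (K i))
    (κ : I → C) (hκ : Function.Surjective κ) (A : Subgroup (L ≃ₐ[ℚ] L)) (hA : ∀ a ∈ A, ∀ b ∈ A, a * b = b * a)
    (C₀ : Finset C)
    (hnot : CMAlgebra.cmFamilyRank (fun i : {i // κ i ∈ C₀} => Φ i.1) + C₀.card ≠
      (∑ c ∈ C₀, CMAlgebra.cmFamilyRank fun i : {i // κ i = c} => Φ i.1) + 1)
    (hmin : ∀ T : Finset C, T ⊂ C₀ → T.Nonempty →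
      CMAlgebra.cmFamilyRank (fun i : {i // κ i ∈ T} => Φ i.1) + T.card =
        (∑ c ∈ T, CMAlgebra.cmFamilyRank fun i : {i // κ i = c} => Φ i.1) + 1) :
    C₀.card ≤ A.index + 1 := by
  classical
  obtain ⟨r, hr, hsurj⟩ := exists_restrictHom ι
  haveI : ∀ i, Nonempty (K i →+* ℂ) := fun i => inferInstance
  have hindex : (A.comap r).index = A.index := A.index_comap_of_surjective hsurj
  haveI : (A.comap r).FiniteIndex := ⟨by rw [hindex]; exact Subgroup.FiniteIndex.index_ne_zero⟩
  rw [← hindex]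
  exact IrrOdd.card_le_index_succ_fiber_of_minimal (G := ℂ ≃+* ℂ) (E := fun i => K i →+* ℂ)
    (Φ := fun i => (Φ i).1) (fun i => isCMTypeWith_conj (Φ i)) κ hκ (A.comap r)
    (smul_comm_of_comap_restrictHom ι e hr A hA) C₀ hnot hmin

omit [Fintype C] in
/-- **`Gal(L/ℚ)` ABELIAN: MINIMAL BLOCK INTERACTIONS INVOLVE TWO BLOCKS.** [cite: Gordon1999HodgeAVSurvey, §3 Theorem and 7.5–7.7]
[cite: MoonenZarhin1999LowDim, §3 (3.1) and Remark (3.9)] -/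
theorem card_le_two_fiber_of_minimal_of_comm (ι : L →+* ℂ) (e : ∀ i, K i →+* L) (Φ : ∀ i, CMType (K i))
    (κ : I → C) (hκ : Function.Surjective κ) (hG : ∀ a b : L ≃ₐ[ℚ] L, a * b = b * a) (C₀ : Finset C)
    (hnot : CMAlgebra.cmFamilyRank (fun i : {i // κ i ∈ C₀} => Φ i.1) + C₀.card ≠
      (∑ c ∈ C₀, CMAlgebra.cmFamilyRank fun i : {i // κ i = c} => Φ i.1) + 1)
    (hmin : ∀ T : Finset C, T ⊂ C₀ → T.Nonempty →
      CMAlgebra.cmFamilyRank (fun i : {i // κ i ∈ T} => Φ i.1) + T.card =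
        (∑ c ∈ T, CMAlgebra.cmFamilyRank fun i : {i // κ i = c} => Φ i.1) + 1) :
    C₀.card ≤ 2 := by
  have key := card_le_index_succ_fiber_of_minimal ι e Φ κ hκ ⊤ (fun a _ b _ => hG a b) C₀ hnot hmin
  rwa [Subgroup.index_top] at key

/-! ### §3 Realisations: the first exceptional mixed class across blocks, index form -/

variable {Φ : ∀ i, CMType (K i)} {A : I → AbelianVariety ℂ} {ιA : ∀ i, 𝓞 (K i) →+* End (A i)}
  {θ : ∀ i, K i →+* Module.End ℂ (complexBetti (A i).X 1)}

/-- **THE FIRST EXCEPTIONAL MIXED CLASS ACROSS BLOCKS INVOLVES AT MOST `[Gal(L/ℚ) : A'] + 1` BLOCKS.**  Realisations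
`A_i ⊨ (K_i; Φ_i)`, `K_i ↪ L` Galois, `A' ≤ Gal(L/ℚ)` with pairwise commuting elements, a partition `κ : I ↠ C` whose block
additivity fails.  Then there are a set of blocks `C₀` with `|C₀| ≤ [Gal(L/ℚ) : A'] + 1`, `c₀ ∈ C₀`, `π₁` inside `c₀` and
`π₂` inside `C₀ ∖ {c₀}` with `¬ HodgeClassesProductSpan (⨁ A∘π₁) (⨁ A∘π₂)`. [cite: MoonenZarhin1999LowDim, §3 (3.1)]
[cite: Serre1977, §3.1 Cor. to Thm. 9] [cite: Gordon1999HodgeAVSurvey, 7.5–7.7] -/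
theorem exists_card_le_index_succ_not_hodgeClassesProductSpan_fiber [Nonempty I] (ι : L →+* ℂ)
    (e : ∀ i, K i →+* L) (A' : Subgroup (L ≃ₐ[ℚ] L)) (hA' : ∀ a ∈ A', ∀ b ∈ A', a * b = b * a) (κ : I → C)
    (hκ : Function.Surjective κ) (hA : ∀ i, IsCMTypeRealisation (Φ i) (A i) (ιA i) (θ i))
    (hne : CMAlgebra.cmFamilyRank Φ + Fintype.card C ≠
      (∑ c, CMAlgebra.cmFamilyRank fun i : {i // κ i = c} => Φ i.1) + 1) :
    ∃ (C₀ : Finset C) (c₀ : C), c₀ ∈ C₀ ∧ C₀.card ≤ A'.index + 1 ∧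
      ∃ (N₁ N₂ : ℕ) (_ : NeZero N₁) (_ : NeZero N₂) (π₁ : Fin N₁ → I) (π₂ : Fin N₂ → I),
        (∀ j, κ (π₁ j) = c₀) ∧ (∀ j, κ (π₂ j) ∈ C₀.erase c₀) ∧
          ¬ HodgeClassesProductSpan (⨁ fun j => A (π₁ j)) (⨁ fun j => A (π₂ j)) := by
  obtain ⟨C₀, c₀, hc₀, hnot, hmin, -, N₁, N₂, hN₁, hN₂, π₁, π₂, h₁, h₂, hfail⟩ :=
    exists_minimal_not_hodgeClassesProductSpan_of_cmFamilyRank_fiber_add_card_ne κ hκ hA hne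
  exact ⟨C₀, c₀, hc₀, card_le_index_succ_fiber_of_minimal ι e Φ κ hκ A' hA' C₀ hnot hmin, N₁, N₂, hN₁, hN₂, π₁, π₂,
    h₁, h₂, hfail⟩

/-- **`Gal(L/ℚ)` ABELIAN: THE FIRST EXCEPTIONAL MIXED CLASS ACROSS BLOCKS LIVES ON TWO BLOCKS.**  Realisations
`A_i ⊨ (K_i; Φ_i)` of ARBITRARY CM types of subfields of an abelian Galois number field `L`, a partition `κ : I ↠ C`
(ARBITRARY blocks) with `Hg(∏_i A_i) ⊊ ∏_c Hg(X_c)`.  Then for some blocks `c₀ ≠ c₁` and slot maps `π₁` inside `c₀`,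
`π₂` inside `c₁` the product `(∏_j A_{π₁ j}) × (∏_j A_{π₂ j})` carries a rational Hodge class which is NOT a
`ℂ`-combination of exterior products of Hodge classes of the two factors.
[cite: Gordon1999HodgeAVSurvey, §3 Theorem (Imai, Murty) and 7.5–7.7] [cite: MoonenZarhin1999LowDim, §3 (3.1) and Remark (3.9)] -/
theorem exists_pair_not_hodgeClassesProductSpan_fiber_of_comm [Nonempty I] (ι : L →+* ℂ) (e : ∀ i, K i →+* L)
    (hG : ∀ a b : L ≃ₐ[ℚ] L, a * b = b * a) (κ : I → C) (hκ : Function.Surjective κ)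
    (hA : ∀ i, IsCMTypeRealisation (Φ i) (A i) (ιA i) (θ i))
    (hne : CMAlgebra.cmFamilyRank Φ + Fintype.card C ≠
      (∑ c, CMAlgebra.cmFamilyRank fun i : {i // κ i = c} => Φ i.1) + 1) :
    ∃ (c₀ c₁ : C), c₀ ≠ c₁ ∧
      ∃ (N₁ N₂ : ℕ) (_ : NeZero N₁) (_ : NeZero N₂) (π₁ : Fin N₁ → I) (π₂ : Fin N₂ → I),
        (∀ j, κ (π₁ j) = c₀) ∧ (∀ j, κ (π₂ j) = c₁) ∧
          ¬ HodgeClassesProductSpan (⨁ fun j => A (π₁ j)) (⨁ fun j => A (π₂ j)) := by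
  classical
  obtain ⟨C₀, c₀, hc₀, hC₀, N₁, N₂, hN₁, hN₂, π₁, π₂, h₁, h₂, hnot⟩ :=
    exists_card_le_index_succ_not_hodgeClassesProductSpan_fiber ι e ⊤ (fun a _ b _ => hG a b) κ hκ hA hne
  rw [Subgroup.index_top] at hC₀
  haveI := hN₂
  have hcard : (C₀.erase c₀).card ≤ 1 := by
    rw [Finset.card_erase_of_mem hc₀]
    omega
  have h0 : κ (π₂ 0) ∈ C₀.erase c₀ := h₂ 0
  refine ⟨c₀, κ (π₂ 0), fun h => (Finset.mem_erase.1 h0).1 h.symm, N₁, N₂, hN₁, hN₂, π₁, π₂, h₁, fun j => ?_, hnot⟩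
  exact Finset.card_le_one.1 hcard _ (h₂ j) _ h0

end Summit.HodgeConjecture.CorCM

end
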